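import Literature.Topology.FourManifolds.TautFoliationsNullTransportM
import Literature.Topology.FourManifolds.TautFoliationsVanishingCycle
import HarnessLib

/-!
# A vanishing cycle from a one-sided closed fence

Topic: codimension-one `C⁰` foliations, Novikov's vanishing cycles (Camacho–Lins Neto, Ch. VII
§2–§3). Let `Φ` be a fence over the unit interval whose levels `a + sg t`, `t ∈ [0, δ)`
(`sg = ±1`: one side of the level `a`), are admissible and closed (`Φ 1 = Φ 0` there), with the
horizontal loop at the level `a` **not** null-homotopic in the leaf topology and the horizontal
loops at the levels `a + sg t`, `0 < t < δ`, null-homotopic. Then `f_t(θ) = Φ θ (a + sg t)` is a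
**vanishing cycle** of the foliation (`Foliation.VanishingCycle`): the curves `t ↦ f_t(θ)` are
verticals of the fence, topologically transverse (their heights in the box of a local datum are
the injective function `ψ` of the level).

* `Path.homotopic_refl_iff_of_forall_eq` (**proved**): null-homotopy of loops is invariant under
  pointwise equality (with possibly different base-point expressions).
* `IsFenceOn.exists_vanishingCycle_of_levels` (**proved**).
* `IsFenceOn.exists_vanishingCycle_of_nullLevel` (**proved**): case (2a) of the trichotomy —
  one-sided closed levels, the base level essential, some close level null ⇒ a vanishing cycle
  (infimum argument with the transport theorem `exists_forall_nullLevel`).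

All statements are [folklore].
-/

noncomputable section

open Set Filter Function
open scoped Topology unitInterval

/-- Two loops which are pointwise equal are simultaneously null-homotopic. [folklore] -/
theorem Path.homotopic_refl_iff_of_forall_eq {X : Type*} [TopologicalSpace X] {x y : X} {ℓ₁ : Path x x} {ℓ₂ : Path y y}
    (h : ∀ t, ℓ₁ t = ℓ₂ t) : ℓ₁.Homotopic (Path.refl x) ↔ ℓ₂.Homotopic (Path.refl y) := by
  have hxy : x = y := by rw [← ℓ₁.source, ← ℓ₂.source]; exact h 0
  subst hxy
  have heq : ℓ₁ = ℓ₂ := Path.ext (funext h)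
  rw [heq]

namespace Literature.Topology.FourManifolds

namespace Foliation

variable {B : Type*} [NormedAddCommGroup B] {M : Type*} [TopologicalSpace M] {F : Foliation B M}
variable {Γ : C(I, F.GermSpace)} {τ₀ ε : ℝ} {Φ : I → ℝ → M}

/-- **A vanishing cycle from a one-sided closed fence.** See the module docstring.
[cite: CamachoLinsNeto1985, Ch. VII §2] -/
theorem IsFenceOn.exists_vanishingCycle_of_levels (hΦ : IsFenceOn F Γ τ₀ ε Φ univ) {a sg δ : ℝ}
    (hsg : sg = 1 ∨ sg = -1) (hδ : 0 < δ) (hadm : ∀ t ∈ Ico 0 δ, a + sg * t ∈ Ioo (τ₀ - ε) (τ₀ + ε))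
    (hcl : ∀ t ∈ Ico 0 δ, Φ 1 (a + sg * t) = Φ 0 (a + sg * t))
    (hess : ∃ (ha : a ∈ Ioo (τ₀ - ε) (τ₀ + ε)) (hcla : Φ 1 a = Φ 0 a), ¬ (hΦ.horizLoop a ha hcla).Homotopic (Path.refl _))
    (hnull : ∀ t ∈ Ioo 0 δ, hΦ.NullLevel (a + sg * t)) :
    ∃ C : F.VanishingCycle, C.ε = δ ∧ ∀ t θ, C.fam t θ = Φ θ (a + sg * t) := by
  have hsg0 : sg ≠ 0 := by rcases hsg with rfl | rfl <;> norm_num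
  have h0 : (0 : ℝ) ∈ Ico 0 δ := ⟨le_rfl, hδ⟩
  -- the family
  set fam : ℝ → I → M := fun t θ ↦ Φ θ (a + sg * t) with hfam
  have hcont : ContinuousOn (uncurry fam) (Ico 0 δ ×ˢ univ) := by
    have hc : Continuous fun p : ℝ × I ↦ ((p.2, a + sg * p.1) : I × ℝ) :=
      continuous_snd.prodMk (continuous_const.add (continuous_const.mul continuous_fst))
    refine (hΦ.cont.comp hc.continuousOn fun p hp ↦ ⟨mem_univ _, hadm p.1 hp.1⟩).congr fun p _ ↦ ?_
    rfl
  have hleaf : ∀ t ∈ Ico 0 δ, Continuous (toLeafSpace ∘ fam t : I → F.LeafSpace) := fun t ht ↦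
    hΦ.continuous_toLeafSpace (hadm t ht)
  have hclosed : ∀ t ∈ Ico 0 δ, fam t 1 = fam t 0 := fun t ht ↦ hcl t ht
  -- comparison of the closed leaf paths with the horizontal loops
  have hcmp : ∀ t (ht : t ∈ Ico 0 δ) (hτ : a + sg * t ∈ Ioo (τ₀ - ε) (τ₀ + ε)) (hc : Φ 1 (a + sg * t) = Φ 0 (a + sg * t)),
      (F.closedLeafPath (fam t) (hleaf t ht) (hclosed t ht)).Homotopic (Path.refl _) ↔
        (hΦ.horizLoop (a + sg * t) hτ hc).Homotopic (Path.refl _) :=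
    fun t ht hτ hc ↦ Path.homotopic_refl_iff_of_forall_eq fun θ ↦ rfl
  refine ⟨{ ε := δ
            ε_pos := hδ
            fam := fam
            continuousOn := hcont
            closed := hclosed
            leafwise := hleaf
            not_homotopic_zero := fun hhom ↦ ?_
            homotopic_refl := fun t ht ↦ ?_
            transverse := fun θ t ht ↦ ?_ }, rfl, fun t θ ↦ rfl⟩
  · -- essential at `t = 0`
    obtain ⟨ha, hcla, hess⟩ := hess
    refine hess ((Path.homotopic_refl_iff_of_forall_eq (ℓ₁ := F.closedLeafPath (fam 0) (hleaf 0 h0) (hclosed 0 h0))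
      (ℓ₂ := hΦ.horizLoop a ha hcla) fun θ ↦ ?_).1 hhom)
    show toLeafSpace (Φ θ (a + sg * 0)) = toLeafSpace (Φ θ a)
    rw [mul_zero, add_zero]
  · -- null for `0 < t < δ`
    obtain ⟨hτ, hc, hhom⟩ := hnull t ht
    exact (hcmp t ⟨ht.1.le, ht.2⟩ hτ hc).2 hhom
  · -- transversality: the verticals of the fence
    obtain ⟨U, hU, D, hD⟩ := hΦ.local_level θ (mem_univ θ)
    have hθU : θ ∈ U ∩ univ := ⟨mem_of_mem_nhds hU, mem_univ θ⟩
    refine ⟨D.box, D.box_mem, 1, one_pos, fun s hs ↦ (hD θ hθU _ (hadm s hs.1)).1, fun s hs s' hs' hss' ↦ ?_⟩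
    have h1 := (hD θ hθU _ (hadm s hs.1)).2
    have h2 := (hD θ hθU _ (hadm s' hs'.1)).2
    simp only at hss'
    rw [show (D.box (fam s θ)).2 = height D.box (fam s θ) from rfl, h1,
      show (D.box (fam s' θ)).2 = height D.box (fam s' θ) from rfl, h2] at hss'
    have h3 := D.ψ_inj (hadm s hs.1) (hadm s' hs'.1) hss'
    have h4 : sg * s = sg * s' := by linarith
    exact mul_left_cancel₀ hsg0 h4

/-- **A vanishing cycle from one-sided trivial holonomy with a null lift** (case (2a) of the
trichotomy for an essential loop with null-homotopic image). Let `Φ` be a fence over the unit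
interval whose initial germ is the height germ of `e₀`, with vertical at `0` along the plaques of
`e₀`, whose base level is not a null level, and whose levels `τ₀ + sg u`, `u ∈ [0, δ')`, are
closed. If some such level close to `τ₀` is a null level, the foliation has a vanishing cycle
made of horizontals of the fence. Proof: below the null level `τ*`, the infimum `c` of the
parameters from which on all levels up to `τ*` are null is an essential closed level (by the
transport theorem a null level is interior to the null levels), and
`exists_vanishingCycle_of_levels` applies at `c`. [cite: CamachoLinsNeto1985, Ch. VII §2] -/
theorem IsFenceOn.exists_vanishingCycle_of_nullLevel [NormedSpace ℝ B] [LocallyConnectedSpace B] [Nonempty B]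
    (hΦ : IsFenceOn F Γ τ₀ ε Φ univ) (hε : 0 < ε)
    {e₀ : OpenPartialHomeomorph M (B × ℝ)} (he₀ : e₀ ∈ F.atlas) (hΓ₀ : (Γ 0).germ = ↑(height e₀))
    (hvert : ∀ τ ∈ Ioo (τ₀ - ε) (τ₀ + ε), Φ 0 τ ∈ plaque e₀ τ) (hess₀ : ¬ hΦ.NullLevel τ₀)
    {sg : ℝ} (hsg : sg = 1 ∨ sg = -1) {δ' : ℝ} (hδ' : 0 < δ')
    (hclosed : ∀ u ∈ Ico 0 δ', τ₀ + sg * u ∈ Ioo (τ₀ - ε) (τ₀ + ε) → Φ 1 (τ₀ + sg * u) = Φ 0 (τ₀ + sg * u)) :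
    ∃ η > (0 : ℝ), ∀ u ∈ Ioo 0 η, hΦ.NullLevel (τ₀ + sg * u) →
      ∃ C : F.VanishingCycle, ∃ c ∈ Ico 0 u, C.ε = u - c ∧ ∀ t θ, C.fam t θ = Φ θ (τ₀ + sg * (c + t)) := by
  have hsg0 : sg ≠ 0 := by rcases hsg with rfl | rfl <;> norm_num
  have hsg1 : |sg| = 1 := by rcases hsg with rfl | rfl <;> norm_num
  obtain ⟨η, hη, hηε, htrans⟩ := hΦ.exists_forall_nullLevel hε he₀ hΓ₀ hvert
  -- admissibility of the levels `τ₀ + sg * u`, `|u| < η'`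
  set η' := min η δ' with hη'
  have hη'pos : 0 < η' := lt_min hη hδ'
  have hadm : ∀ u, |u| < η' → τ₀ + sg * u ∈ Ioo (τ₀ - η) (τ₀ + η) := fun u hu ↦ by
    have h1 : |sg * u| < η := by rw [abs_mul, hsg1, one_mul]; exact hu.trans_le (min_le_left _ _)
    rw [abs_lt] at h1
    constructor <;> linarith [h1.1, h1.2]
  have hadmε : ∀ u, |u| < η' → τ₀ + sg * u ∈ Ioo (τ₀ - ε) (τ₀ + ε) := fun u hu ↦ by
    have h := hadm u hu
    exact ⟨by linarith [h.1], by linarith [h.2]⟩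
  have hη'δ : η' ≤ δ' := min_le_right _ _
  refine ⟨η', hη'pos, fun u hu hnullu ↦ ?_⟩
  -- null levels in parameter form, and their openness (transport) inside `[0, η')`
  set Nl : ℝ → Prop := fun v ↦ hΦ.NullLevel (τ₀ + sg * v) with hNl
  have hopen : ∀ v ∈ Ico 0 η', Nl v → ∃ κ > (0 : ℝ), ∀ w ∈ Ioo (v - κ) (v + κ), w ∈ Ico 0 η' → Nl w := by
    intro v hv hNv
    have hvabs : |v| < η' := by rw [abs_of_nonneg hv.1]; exact hv.2
    obtain ⟨κ, hκ, hall⟩ := htrans (τ₀ + sg * v) (hadm v hvabs) hNv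
    refine ⟨κ, hκ, fun w hw hw' ↦ ?_⟩
    have hwabs : |w| < η' := by rw [abs_of_nonneg hw'.1]; exact hw'.2
    have hwI : τ₀ + sg * w ∈ Ioo (τ₀ + sg * v - κ) (τ₀ + sg * v + κ) := by
      have h1 : |sg * (w - v)| < κ := by
        rw [abs_mul, hsg1, one_mul, abs_lt]; constructor <;> linarith [hw.1, hw.2]
      rw [abs_lt] at h1
      constructor <;> nlinarith [h1.1, h1.2]
    exact hall _ hwI (hclosed w ⟨hw'.1, hw'.2.trans_le hη'δ⟩ (hadmε w hwabs))
  -- the infimum `c` of the parameters from which on all levels up to `u` are null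
  set S : Set ℝ := {s | s ∈ Icc 0 u ∧ ∀ w ∈ Ioc s u, Nl w} with hS
  have huS : u ∈ S := ⟨⟨hu.1.le, le_rfl⟩, fun w hw ↦ absurd hw.2 (not_le.2 hw.1)⟩
  have hSne : S.Nonempty := ⟨u, huS⟩
  have hSbdd : BddBelow S := ⟨0, fun s hs ↦ hs.1.1⟩
  set c := sInf S with hc
  have hc0 : 0 ≤ c := le_csInf hSne fun s hs ↦ hs.1.1
  have hcu : c ≤ u := csInf_le hSbdd huS
  have hcη : c < η' := hcu.trans_lt hu.2
  -- (P1) all parameters in `(c, u]` are null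
  have hP1 : ∀ w ∈ Ioc c u, Nl w := by
    intro w hw
    obtain ⟨s, hs, hsw⟩ := exists_lt_of_csInf_lt hSne hw.1
    exact hs.2 w ⟨hsw, hw.2⟩
  -- a null parameter `v ∈ [0, u]` with all of `(v, u]` null is not the infimum unless ... : key step
  have hstep : ∀ v ∈ Icc c u, Nl v → ∃ s ∈ S, s < v ∨ v = 0 := by
    intro v hv hNv
    by_cases hv0 : v = 0
    · exact ⟨u, huS, Or.inr hv0⟩
    have hvpos : 0 < v := lt_of_le_of_ne (hc0.trans hv.1) (Ne.symm hv0)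
    obtain ⟨κ, hκ, hκall⟩ := hopen v ⟨hvpos.le, hv.2.trans_lt hu.2⟩ hNv
    set s := max 0 (v - κ / 2) with hs
    have hsv : s < v := max_lt hvpos (by linarith)
    refine ⟨s, ⟨⟨le_max_left _ _, hsv.le.trans hv.2⟩, fun w hw ↦ ?_⟩, Or.inl hsv⟩
    rcases le_or_gt w v with hwv | hwv
    · -- `w ∈ (s, v]`: transport from `v`
      refine hκall w ⟨?_, by linarith⟩ ⟨(le_max_left _ _).trans hw.1.le, (hwv.trans hv.2).trans_lt hu.2⟩
      have : v - κ / 2 ≤ s := le_max_right _ _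
      linarith [hw.1]
    · -- `w ∈ (v, u]`, `v ≥ c`
      exact hP1 w ⟨hv.1.trans_lt hwv, hw.2⟩
  -- (P2) `c < u`
  have hcu' : c < u := by
    obtain ⟨s, hs, h⟩ := hstep u ⟨hcu, le_rfl⟩ hnullu
    rcases h with h | h
    · exact (csInf_le hSbdd hs).trans_lt h
    · exact absurd h hu.1.ne'
  -- (P3) `c` is not a null parameter
  have hNc : ¬ Nl c := by
    intro hN
    obtain ⟨s, hs, h⟩ := hstep c ⟨le_rfl, hcu⟩ hN
    rcases h with h | h
    · exact not_le.2 h (csInf_le hSbdd hs)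
    · apply hess₀
      have h' : hΦ.NullLevel (τ₀ + sg * c) := hN
      rwa [h, mul_zero, add_zero] at h'
  -- the vanishing cycle at the level `τ₀ + sg * c`
  have hcabs : |c| < η' := by rw [abs_of_nonneg hc0]; exact hcη
  have hca : τ₀ + sg * c ∈ Ioo (τ₀ - ε) (τ₀ + ε) := hadmε c hcabs
  have hccl : Φ 1 (τ₀ + sg * c) = Φ 0 (τ₀ + sg * c) := hclosed c ⟨hc0, hcη.trans_le hη'δ⟩ hca
  have hlev : ∀ t, τ₀ + sg * c + sg * t = τ₀ + sg * (c + t) := fun t ↦ by ring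
  obtain ⟨C, hCε, hCfam⟩ := hΦ.exists_vanishingCycle_of_levels (a := τ₀ + sg * c) hsg (sub_pos.2 hcu')
    (fun t ht ↦ by
      rw [hlev]
      exact hadmε _ (by rw [abs_of_nonneg (by linarith [ht.1])]; linarith [ht.2, hu.2]))
    (fun t ht ↦ by
      rw [hlev]
      have h1 : c + t ∈ Ico 0 δ' := ⟨by linarith [ht.1], by linarith [ht.2, hη'δ, hu.2]⟩
      exact hclosed _ h1 (hadmε _ (by rw [abs_of_nonneg (by linarith [ht.1])]; linarith [ht.2, hu.2])))
    ⟨hca, hccl, fun h ↦ hNc ⟨hca, hccl, h⟩⟩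
    (fun t ht ↦ by
      rw [hlev]
      exact hP1 (c + t) ⟨by linarith [ht.1], by linarith [ht.2]⟩)
  refine ⟨C, c, ⟨hc0, hcu'⟩, hCε, fun t θ ↦ ?_⟩
  rw [hCfam, hlev]

end Foliation

end Literature.Topology.FourManifolds
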